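import Summits.SmoothPoincare4.SmoothPoincare4.Theorems.SblfDescentRungOneHelperFoldNFPageHessianChart
import Summits.SmoothPoincare4.SmoothPoincare4.Theorems.SblfDescentRungOneHelperTimelikeNappeDichotomy
import HarnessLib

/-!
# The nappe dichotomy for the page Hessians along the round circle of a genus-one SBLF

Helper layer `helper_timelike_dichotomy` of stub `helper_foldNF_timelike` (the untwistedness of
the round `1`-handle), line `Sketch`, crux `SblfDescent.RungOne`.

(Crux item stmt-SmoothPoincare4-18531; skeleton `Cruxes/RungOne/Lines/Sketch.lean`.)

Let `f : X → S²` be a genus-one Lefschetz-free SBLF with equatorial round image, `v` the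
torus-side pole, `e` the round circle by longitude, `ν₀` a tube about it and
`g (t, x) = ⟪v, f (ν₀ (circlePt t, x))⟫` the `1`-periodic height family
(`helper_foldNF_family`), whose page Hessians `H_t = ∂ₓ∂ₓ g (t, 0)` are nondegenerate of index
one (`helper_foldNF_pageHessianAt`: `H_t = c_t · 2 B (P_t ·, P_t ·)`, `c_t ≠ 0`, `P_t`
injective, `c_0 > 0`).  The generic nappe dichotomy (`helper_timelike_nappeDichotomy`: a frame
along `[0, 1]`, O'Neill's timecone lemma, closing up in a convex nappe) then gives: EITHER a
continuous `1`-periodic field of `H_t`-timelike vectors exists (the conclusion of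
`helper_foldNF_timelike`), OR a continuous `H_t`-timelike field `n` with `n (t + 1) = -n t`
exists — the twisted alternative, to be excluded geometrically (`helper_timelike_noReversal`).

## References

* B. O'Neill, *Semi-Riemannian Geometry* (1983), Ch. 5, Lemma 26 and Lemma 29. [ONeill1983]
* M. W. Hirsch, *Differential Topology*, GTM 33 (1976), Ch. 6 §1. [HirschDT1976]
* K. Hayano, *On genus-1 simplified broken Lefschetz fibrations*, Algebr. Geom. Topol. 11
  (2011), Def. 2.1 (4). [Hayano2011]
-/

set_option linter.dupNamespace false

noncomputable section

open scoped Manifold ContDiff Topology RealInnerProductSpace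
open Set Function Filter Metric Literature.Topology.FourManifolds
  Literature.AlgebraicTopology.SingularHomology

namespace Summit.SmoothPoincare4.SmoothPoincare4.Cruxes.RungOne.Sketch

/-- Local notation: `𝔼 n` is the model Euclidean space `EuclideanSpace ℝ (Fin n)`. -/
local notation "𝔼 " n:arg => EuclideanSpace ℝ (Fin n)

/-- Local notation: `𝕊²`, the unit sphere of `ℝ³`. -/
local notation "𝕊²" => (Metric.sphere (0 : EuclideanSpace ℝ (Fin 3)) (1 : ℝ))

attribute [local instance] Literature.Topology.FourManifolds.fact_finrank_euclideanSpace_succ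

/-- **A form congruent to a nonzero multiple of the standard index-one form is nondegenerate**:
if `H (a, b) = c · 2 (P a · P b)_{(+,+,-)}` with `c ≠ 0` and `P` injective, then
`H (a, ·) = 0 ⇒ a = 0`. [folklore] -/
theorem eq_zero_of_congruent_sliceForm {H : 𝔼 3 →L[ℝ] 𝔼 3 →L[ℝ] ℝ} {c : ℝ} (hc : c ≠ 0)
    {P : 𝔼 3 →L[ℝ] 𝔼 3} (hP : Injective P)
    (hH : ∀ a b : 𝔼 3, H a b =
      c * (2 * ((P a) 0 * (P b) 0 + (P a) 1 * (P b) 1 - (P a) 2 * (P b) 2)))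
    (a : 𝔼 3) (ha : ∀ b : 𝔼 3, H a b = 0) : a = 0 := by
  set Pe : 𝔼 3 ≃L[ℝ] 𝔼 3 := (LinearEquiv.ofInjectiveEndo P.toLinearMap hP).toContinuousLinearEquiv
    with hPe
  have hPe' : ∀ a, Pe a = P a := fun a => rfl
  have hco : ∀ y : 𝔼 3, (P a) 0 * y 0 + (P a) 1 * y 1 - (P a) 2 * y 2 = 0 := fun y => by
    have h := ha (Pe.symm y)
    rw [hH, ← hPe' (Pe.symm y), ContinuousLinearEquiv.apply_symm_apply] at h
    simpa [hc] using h
  have h0 := hco (EuclideanSpace.single 0 1)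
  have h1 := hco (EuclideanSpace.single 1 1)
  have h2 := hco (EuclideanSpace.single 2 1)
  simp at h0 h1 h2
  have hz : Pe a = 0 := by
    rw [hPe']
    ext i; fin_cases i
    · simpa using h0
    · simpa using h1
    · simpa using h2
  simpa using congrArg Pe.symm hz

/-- **A Lorentz frame for the pull-back of the standard index-one form.**  For an invertible
`P : ℝ³ ≃L ℝ³`, the form `B (a, b) = (P a)₀(P b)₀ + (P a)₁(P b)₁ - (P a)₂(P b)₂` has
`B (v₀, v₀) = -1` for `v₀ = P⁻¹ e₂`, and every `x` expands as
`x = -B (v₀, x) v₀ + B (b₁, x) b₁ + B (b₂, x) b₂` with `b₁ = P⁻¹ e₀`, `b₂ = P⁻¹ e₁`. [folklore] -/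
theorem lorentzFrame_of_equiv' (P : 𝔼 3 ≃L[ℝ] 𝔼 3) {B : 𝔼 3 →L[ℝ] 𝔼 3 →L[ℝ] ℝ}
    (hB : ∀ a b : 𝔼 3, B a b = (P a) 0 * (P b) 0 + (P a) 1 * (P b) 1 - (P a) 2 * (P b) 2) :
    B (P.symm (EuclideanSpace.single 2 1)) (P.symm (EuclideanSpace.single 2 1)) = -1 ∧
    ∀ x : 𝔼 3, x = (-B (P.symm (EuclideanSpace.single 2 1)) x) • P.symm (EuclideanSpace.single 2 1) +
      B (P.symm (EuclideanSpace.single 0 1)) x • P.symm (EuclideanSpace.single 0 1) +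
      B (P.symm (EuclideanSpace.single 1 1)) x • P.symm (EuclideanSpace.single 1 1) := by
  simp only [hB, ContinuousLinearEquiv.apply_symm_apply]
  refine ⟨by simp, fun x => ?_⟩
  apply P.injective
  simp only [map_add, map_smul, ContinuousLinearEquiv.apply_symm_apply]
  ext i
  fin_cases i <;> simp

/-- **The nappe dichotomy for the page Hessians along the round circle.**  For a genus-one
Lefschetz-free SBLF with equatorial round image, torus-side pole `v`, round circle `e` and tube
`ν₀`, with `g (t, x) = ⟪v, f (ν₀ (circlePt t, x))⟫` and `H_t = ∂ₓ∂ₓ g (t, 0)`: either there is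
a continuous `1`-periodic field `w` with `H_t (w t, w t) < 0`, or there is a continuous field
`n` with `H_t (n t, n t) < 0` and `n (t + 1) = -n t`.  [`H_t` is nondegenerate of index one
with `H_0` a positive multiple of the standard form (`helper_foldNF_pageHessianAt`); apply the
generic dichotomy `helper_timelike_nappeDichotomy`.] [cite: ONeill1983, Ch. 5, Lemma 26 and Lemma 29]
[cite: HirschDT1976, Ch. 6 §1] [cite: Hayano2011, Def. 2.1 (4)] -/
theorem helper_timelike_dichotomy : ∀ (X : Type) [TopologicalSpace X] [T2Space X] [SecondCountableTopology X] [CompactSpace X] [ChartedSpace (𝔼 4) X] [IsManifold (𝓡 4) ∞ X] (o : SmoothOrientation (𝓡 4) X) (f : X → 𝕊²), IsSimplifiedBrokenLefschetzFibration o f ∅ 0 → f '' ({p : X | ¬ Surjective (mfderiv (𝓡 4) (𝓡 2) f p)} \ (↑(∅ : Finset X) : Set X)) = sphereEquator 1 → ∀ (v : 𝕊²), (v : 𝔼 3) 0 = 0 → (v : 𝔼 3) 1 = 0 → (∀ y : 𝕊², ⟪(y : 𝔼 3), (v : 𝔼 3)⟫ < 0 → (∀ q, f q = y → Surjective (mfderiv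 (𝓡 4) (𝓡 2) f q)) ∧ Nonempty ((Fin (2 * 0) → ℤ) ≃ₗ[ℤ] singularHomology ℤ ℤ ↥(f ⁻¹' {y}) 1)) → (∀ y : 𝕊², ⟪(y : 𝔼 3), ((-v : 𝕊²) : 𝔼 3)⟫ < 0 → (∀ q, f q = y → Surjective (mfderiv (𝓡 4) (𝓡 2) f q)) ∧ Nonempty ((Fin (2 * (0 + 1)) → ℤ) ≃ₗ[ℤ] singularHomology ℤ ℤ ↥(f ⁻¹' {y}) 1)) → ∀ (e : Metric.sphere (0 : 𝔼 2) 1 → X) (ν₀ : CircleNbhd (𝓡 4) e), Set.range e = {p : X | ¬ Surjective (mfderiv (𝓡 4) (𝓡 2) f p)} \ (↑(∅ : Finset X) : Set X) → (∀ u, f (e u) = sphereInclusion 1 2 one_le_two u) → (∃ w : ℝ → 𝔼 3, Continuous w ∧ (∀ t : ℝ, w (t + 1) = w t) ∧ ∀ t : ℝ, fderiv ℝ (fderiv ℝ (fun q : ℝ × 𝔼 3 => SphereHeight.height (v : 𝔼 3) (f (ν₀.toFun (circlePt q.1, q.2))))) (t, 0) ((0 : ℝ), w t) ((0 : ℝ),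 w t) < 0) ∨ (∃ n : ℝ → 𝔼 3, Continuous n ∧ (∀ t : ℝ, n (t + 1) = -n t) ∧ ∀ t : ℝ, fderiv ℝ (fderiv ℝ (fun q : ℝ × 𝔼 3 => SphereHeight.height (v : 𝔼 3) (f (ν₀.toFun (circlePt q.1, q.2))))) (t, 0) ((0 : ℝ), n t) ((0 : ℝ), n t) < 0) := by
  intro X _ _ _ _ _ _ o f hf hround v hv0 hv1 hlo hhi e ν₀ hrange hfe
  have hAt := helper_foldNF_pageHessianAt X o f hf hround v hv0 hv1 hlo hhi e ν₀ hrange hfe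
  obtain ⟨-, -, -, hgs, -, -, -⟩ := helper_foldNF_family X o f hf hround v hv0 hv1 e ν₀ hrange hfe
  set g : ℝ × 𝔼 3 → ℝ := fun q => SphereHeight.height (v : 𝔼 3) (f (ν₀.toFun (circlePt q.1, q.2)))
    with hgdef
  have hgT : ∀ (t : ℝ) (u : 𝔼 3), g (t + 1, u) = g (t, u) := fun t u => by
    simp [hgdef, circlePt_add_one]
  -- the page Hessians as bilinear maps; nondegeneracy at every `t`
  set Hf : ℝ → 𝔼 3 →L[ℝ] 𝔼 3 →L[ℝ] ℝ := fun t =>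
    (fderiv ℝ (fderiv ℝ g) (t, 0)).bilinearComp (ContinuousLinearMap.inr ℝ ℝ (𝔼 3))
      (ContinuousLinearMap.inr ℝ ℝ (𝔼 3)) with hHf
  have hHap : ∀ (t : ℝ) (a b : 𝔼 3), Hf t a b = fderiv ℝ (fderiv ℝ g) (t, 0) ((0 : ℝ), a) ((0 : ℝ), b) :=
    fun t a b => by simp [hHf]
  have hnd : ∀ (t : ℝ) (a : 𝔼 3),
      (∀ b, fderiv ℝ (fderiv ℝ g) (t, 0) ((0 : ℝ), a) ((0 : ℝ), b) = 0) → a = 0 := by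
    intro t a ha
    obtain ⟨c, P, hc, hP, hH, -⟩ := hAt t
    exact eq_zero_of_congruent_sliceForm (H := Hf t) hc hP (fun a b => by rw [hHap]; exact hH a b)
      a (fun b => by rw [hHap]; exact ha b)
  -- the reference form at `t = 0`: `H_0 = (2c) · B`, `B (a, b) = Q (P a, P b)`
  obtain ⟨c, P, -, hPinj, hH0, hc0⟩ := hAt 0
  have hc : 0 < c := hc0 rfl
  set Pe : 𝔼 3 ≃L[ℝ] 𝔼 3 := (LinearEquiv.ofInjectiveEndo P.toLinearMap hPinj).toContinuousLinearEquiv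
    with hPe
  have hPe' : ∀ a, Pe a = P a := fun a => rfl
  obtain ⟨Bq, hBq⟩ := exists_clm_sliceForm
  set B : 𝔼 3 →L[ℝ] 𝔼 3 →L[ℝ] ℝ := Bq.bilinearComp (Pe : 𝔼 3 →L[ℝ] 𝔼 3) (Pe : 𝔼 3 →L[ℝ] 𝔼 3)
    with hBdef
  have hB : ∀ a b : 𝔼 3, B a b = (Pe a) 0 * (Pe b) 0 + (Pe a) 1 * (Pe b) 1 - (Pe a) 2 * (Pe b) 2 :=
    fun a b => by simp [hBdef, hBq]
  have hBsymm : ∀ a b, B a b = B b a := fun a b => by rw [hB, hB]; ring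
  have hHB : ∀ a b : 𝔼 3, fderiv ℝ (fderiv ℝ g) ((0 : ℝ), (0 : 𝔼 3)) ((0 : ℝ), a) ((0 : ℝ), b) =
      (2 * c) * B a b := fun a b => by
    rw [hB, hPe', hPe', hH0 a b]; ring
  obtain ⟨hv, hexp⟩ := lorentzFrame_of_equiv' Pe hB
  exact helper_timelike_nappeDichotomy (𝔼 3) g hgs hgT hnd B hBsymm (2 * c) (by positivity) hHB
    _ _ _ hv hexp

end Summit.SmoothPoincare4.SmoothPoincare4.Cruxes.RungOne.Sketch

end
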